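import Mathlib
import Literature.MathematicalPhysics.QuantumFieldTheory.Balaban1983to89.B9Eq3112

/-!
# `Balaban1983to89.B8Eq157Translation` — T. Bałaban, *Spaces of regular gauge field configurations on a lattice and gauge
# fixing conditions*, Commun. Math. Phys. **99** (1985) 75–102 [Balaban1985RegularSpaces], p. 86 (1.56)–(1.58): the
# translation «A = A₁ + H(U₀)B₁», the equations (1.57) it produces, and BOTH lines of (1.58)
# «A = G(U₀)J − G(U₀)D\*DH(U₀)B₁ + H(U₀)B₁ = G(U₀)J + G(U₀)Σ_jQ\*_jΛ_j(L^jη)⁻³B₁», with H(U₀) = the operator of [4]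
# (3.109)–(3.111) BY NAME (`B9Eq3112.hOp`) and G(U₀) = B8's displayed inverse — kernel-checked at the finite-dimensional
# model level of [4] Sect. D

statement-level skeleton of published theorems with citation tags; proofs where landed; nothing here is a claim about the Yang–Mills mass gap

PDF held: `paper:balaban1985-cmp99-regular-spaces-gauge-fixing` (journal page = PDF page + 74).  Page read for this module:
p. 86 [PDF 12] AS AN IMAGE (render `run/shared/lean/pub/pub-balaban/b2b-balaban-ref1/pages/1985-cmp99-regular-spaces-gauge-fixing-p012-x2.png`,
this session), p. 83 [PDF 9] (1.42) from the `lit read` text layer; [4] = T. Bałaban, *Propagators for lattice gauge theories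
in a background field*, CMP **99** (1985) 389–434 [Balaban1985BackgroundPropagators] p. 417 [PDF 29] (3.109)–(3.111) from the
`lit read` text layer and through the tree module `B9Eq3112` (whose header quotes the page read as an image); [B11] =
T. Bałaban, *The variational problem and background fields in renormalization group method for lattice gauge theories*, CMP
**102** (1985) 277–309 [Balaban1985Variational] p. 285 (45) through the tree module `B11Eq103H1Complex` (header quotation).

CITATION HEADER (lean-in-tree rule).  Cell `lit-balaban`, unit `lit-balaban-r05` gen 11 (B8 fold owner); WHAT IS REPRODUCED =
SKELETON row **B8.Eq1.58** ((1.57)–(1.58); hitherto «typed-existing»: the tree had the H(U₀)-FREE second line of (1.58) over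
bare additive groups, `B8FromB9.b8_158_identity` — «(1.58) is forced, and H(U₀) cancels» — and the Neumann transfer to [4]'s
G; the display (1.57) and the FIRST line of (1.58), i.e. the translation by the operator H(U₀) of [4], had no declaration, and
the cell census recorded «concrete G(U₀), H(U₀) ABSENT»).  This module supplies them at the level at which [4]'s own
definition of H is certified in the tree — the finite-dimensional matrix model of `B9Eq3112`/`B9SectDFP`/`B9H163` (real
matrices over finite index types; `*` ↦ `ᵀ`; cell DIVERGENCE D-b09.53/54/56) — with [4]'s H USED BY NAME, nothing of [4]
restated.  Kind «definition + kernel-checked algebra»; no `… : Prop` fact is introduced; 0 sorry.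

WHAT IS PRINTED (verbatim, p. 86 [PDF 12]).
*"The configuration A satisfies (1.42) also. Proposition 4 from [3] implies that
Q_j(U₀, ηA) = L^jηQ_jA + C_j(L^jηA), |C_j(L^jηA)| ≦ C₂|L^jηA|² < C₂α₂², (1.56)
hence L^jηQ_jA = B₁, B₁ = B − C_j(L^jηA) on Λ_j, |B₁| < 2dLα₁ + C₂α₂². We make the translation A = A₁ + H(U₀)B₁, where the
operator H(U₀) was defined in [4], and we get the equations
D^{η\*}_{U₀}D^η_{U₀}A₁ = J − D^{η\*}_{U₀}D^η_{U₀}H(U₀)B₁,  Q_jA₁ = 0 on Λ_j,  R(U₀)D^{η\*}_{U₀}A₁ = 0. (1.57)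
They imply finally
A = G(U₀)J − G(U₀)D^{η\*}_{U₀}D_{U₀}H(U₀)B₁ + H(U₀)B₁ = G(U₀)J + G(U₀)Σ_j Q\*_jΛ_j(L^jη)⁻³B₁, (1.58)
where the operator G(U₀) was introduced and investigated in [4]. Let us recall only the definition:
G(U₀) = (D^{η\*}_{U₀}D^η_{U₀} + D^η_{U₀}R(U₀)D^{η\*}_{U₀} + Σ_j Q\*_jΛ_j(L^jη)⁻²Q_j)⁻¹."*
With, from the same page, (1.55) *"D^{η\*}_{U₀}D^η_{U₀}A = J"* and, p. 83 [PDF 9], (1.42) *"R(U₀)D^{η\*}_{U₀}A = 0, Q_j(U₀, ηA) = B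
on Λ_j, |B| < 2dLα₁"*.
[4] p. 417 [PDF 29]: *"we define H(U)B, or simply HB, as a minimal configuration of the functional A → ½⟨A, Δ(U)A⟩, (3.109)
on a set of configurations A defined on Ω₀, with values in 𝔤, satisfying L^jηQ_j(U)A = B on Λ_j, j = 0, 1, …, k,
R(U)D\*_UA = 0. (3.110) … For the above linear problem the factor L^jη is unessential because it may be included into the
configuration B. In the future we will write the first condition in (3.110) as Q(U)A = B. The variational problem (3.109),
(3.110) has a unique solution. … hence the existence of a unique minimum on this hyperplane follows from positive
definiteness of the operator Δ_a. This minimum is denoted by HB. It define a linear operator H."* — typed and proved in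
`B9Eq3112` (`hOp`, `hOp_feasible`, `isUnit_kkt_dcon`, `eq_3109_min`).  [B11] p. 285: *"Thus it has the following properties
L^jηQ_jHB = B on Λ_j, RD\*HB = 0, (45)"*.

WHAT THIS MODULE DOES (all statements PROVED).
§1 LETTERS AND ALGEBRA over arbitrary finite index types `b` (bonds of Ω₀ — the vector field A), `p` (plaquettes), `n` (sites),
   `q` (the rows of 𝔅_k = ⋃_jΛ_j): `C : Matrix p b ℝ` = the covariant curl D^η_{U₀} on vector fields ((1.1)/(1.2); [4] (3.4)),
   so that D^{η\*}_{U₀}D^η_{U₀} = CᵀC; `D : Matrix b n ℝ` = the covariant derivative on site functions, D\* = Dᵀ; `R : Matrix n n ℝ`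
   = R(U₀); `Qj : Matrix q b ℝ` = the linear averaging operators Q_j stacked over the levels; `ℓ : q → ℝ` = the level
   weight L^{j(i)}η of the row i ∈ Λ_j, `lev ℓ k = diag((L^jη)^{−k})` = the printed «Λ_j(L^jη)^{−k}».
   * `P8` := CᵀC + DRDᵀ + Qjᵀ·lev ℓ 2·Qj — the operator INSIDE the printed definition of G(U₀); `G8 := P8⁻¹` = **G(U₀)**
     (`G8_mul_P8`/`P8_mul_G8` under `IsUnit P8.det` — B8: «introduced and investigated in [4]»; its invertibility is the
     displayed hypothesis, [4] Thm 3.11-type, never asserted);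
   * `eq156_B1` — «hence L^jηQ_jA = B₁, B₁ = B − C_j(L^jηA)»;
   * **`eq157`** — for ANY operator `H` with the two properties (45) at B₁ (L^jηQ_jHB₁ = B₁, RD\*HB₁ = 0) and any A with
     (1.55), (1.42), «L^jηQ_jA = B₁»: A₁ := A − HB₁ satisfies the three equations (1.57);
   * `P8_mulVec_A1`, `P8_mulVec_H`, `P8_mulVec_A` — P₈A₁ = J − CᵀCHB₁, P₈(HB₁) = CᵀCHB₁ + Qjᵀlev ℓ 3 B₁, P₈A = J + Qjᵀlev ℓ 3 B₁;
   * **`eq158_line1`**, **`eq158_line2`**, `eq158_rhs`, **`eq158`** — «A = G(U₀)J − G(U₀)D\*DH(U₀)B₁ + H(U₀)B₁» and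
     «= G(U₀)J + G(U₀)Σ_jQ\*_jΛ_j(L^jη)⁻³B₁» (the second line also H-free, as in `B8FromB9.b8_158_identity`; the middle
     equality for every J, B₁ from (45) alone);
   * WHAT `IsUnit P8.det` SAYS: `P8_transpose`, `quadForm_P8` (⟨X, P₈X⟩ = ‖D^η_{U₀}X‖² + ‖R(U₀)D^{η\*}_{U₀}X‖² +
     Σ_jΣ_{Λ_j}(L^jη)^{−2}|Q_jX|² for R(U₀) an orthogonal projection), `posDef_P8_of_noZeroModes`, `eq_zero_of_modes`,
     **`isUnit_P8_det_iff`** — B8's G(U₀) exists iff no X ≠ 0 has D^η_{U₀}X = 0, R(U₀)D^{η\*}_{U₀}X = 0, Q_jX = 0 on all Λ_j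
     (the finite-dimensional content, for B8's operator, of [4] Thm 3.11 «Δ_a, G are positive definite»).
§2 [4]'s LETTERS: R(U₀) := `B9H163.R Δ Q a` ((3.25); Δ = DᵀD the site Laplacian, Q = Q′(U₀), a), H(U₀) := `B9Eq3112.hOp K Δ N D Qb`
   at Qb := diag(L^jη)·Qj (so that [4]'s «Q(U)A = B» IS «L^jηQ_jA = B on Λ_j»): **`hOp_prop45`** — H(U₀) HAS the properties (45)
   (from `B9Eq3112.hOp_feasible`); **`eq157_sectD`**, **`eq158_sectD`** — (1.57) and both lines of (1.58) with THIS H(U₀), for every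
   bond form K (= [4]'s Δ(U) of (3.109), including its curvature part Δ′), every kernel basis N of Q′, every a, under the
   nonsingularity hypotheses displayed by `B9Eq3112` (the bordered matrix of (3.109)–(3.110), `hW`) and `IsUnit P8.det`;
   `eq158_sectD_of_posDef` — the same with `hW` DISCHARGED from [4]'s «positive definiteness of the operator Δ_a»
   (`B9Eq3112.isUnit_kkt_dcon`, Q_j onto, (3.115)).

MODEL / DECLARED READINGS.  (M1) as `B9Eq3112` (D-b09.53/54/56): finite index types, real entries, adjoints = transposes,
the Lie-algebra index absorbed into the index types; B8's D^{η\*}_{U₀}D^η_{U₀} on vector fields is read as CᵀC for a curl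
matrix C (its principal part [4] (3.10); B8 prints D\*D, not [4]'s Δ = D\*D + Δ′ — `B8FromB9` header, census G-IF-01), while
[4]'s H minimises the form of an ARBITRARY bond matrix K (print: Δ(U)); (1.58) needs only the constraints (45) of H, so no
relation between K and CᵀC is assumed.  (M2) «Q_j … on Λ_j» for all j at once = the stacked matrix `Qj` with row weights
`ℓ i = L^{j(i)}η ≠ 0`; «Σ_jQ\*_jΛ_j(L^jη)^{−k}» = `Qjᵀ * lev ℓ k`.  (M3) DISPLAYED, never asserted: invertibility of B8's
P₈ (`hG`), and in §2 the `B9Eq3112` frame hypotheses.  (M4) NOT HERE: the bounds (1.59) ([4] Thm 3.3; `B8FromB9.b8_159_*`),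
(1.56) itself ([3] Prop. 4; row B8.Eq1.56, `B8Eq156Prop4`), any lattice-concrete C, D, Q_j (rows B8.Eq1.1/1.2, `B9Eq34CovCurlVector`,
`B9Eq33CovDerivVector`; the ℤᵈ averaging `B7Prop4GeneralLevels.linCovIter`).
HONEST SCOPE.  Finite-dimensional linear algebra around the printed displays; value = the (1.57)/(1.58)-with-H(U₀) bookkeeping
kernel-checked against [4]'s certified definition of H, NOT an estimate, NOT summit progress.
-/

namespace Literature.MathematicalPhysics.QuantumFieldTheory.Balaban1983to89.B8Eq157Translation

open Matrix
open scoped Matrix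
open Literature.MathematicalPhysics.QuantumFieldTheory.Balaban1983to89.Beta.Composition (kkt)
open B9Eq3112 (hOp dcon)

/-! ## §1  Letters and the algebra of (1.56)–(1.58) -/

section Weights

variable {q : Type*} [DecidableEq q]

/-- The level weights «Λ_j(L^jη)^{−k}»: the diagonal matrix with entry `(L^{j(i)}η)^{−k}` at the row `i ∈ Λ_j` of 𝔅_k
(`ℓ i = L^{j(i)}η`). [cite: Balaban1985RegularSpaces, (1.58) p.86] -/
noncomputable def lev (ℓ : q → ℝ) (k : ℕ) : Matrix q q ℝ := diagonal fun i => (ℓ i)⁻¹ ^ k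

/-- `lev ℓ k` is symmetric. [cite: Balaban1985RegularSpaces, (1.58) p.86] -/
theorem lev_transpose (ℓ : q → ℝ) (k : ℕ) : (lev ℓ k)ᵀ = lev ℓ k := diagonal_transpose _

variable [Fintype q]

/-- `lev ℓ k` acts entrywise: `(lev ℓ k · v) i = (L^jη)^{−k} v i`. [cite: Balaban1985RegularSpaces, (1.58) p.86] -/
theorem lev_mulVec (ℓ : q → ℝ) (k : ℕ) (v : q → ℝ) (i : q) : (lev ℓ k *ᵥ v) i = (ℓ i)⁻¹ ^ k * v i := by
  simp [lev, mulVec_diagonal]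

/-- `lev ℓ k · lev ℓ k′ = lev ℓ (k + k′)`. [cite: Balaban1985RegularSpaces, (1.58) p.86] -/
theorem lev_mul_lev (ℓ : q → ℝ) (k k' : ℕ) : lev ℓ k * lev ℓ k' = lev ℓ (k + k') := by
  simp [lev, diagonal_mul_diagonal, pow_add]

/-- «L^jηQ_jA = B₁ on Λ_j» ⟺ «Q_jA = Λ_j(L^jη)^{−1}B₁»: `diag(ℓ)·v = B₁ ↔ v = lev ℓ 1 · B₁` (ℓ i ≠ 0; print: ℓ = L^jη > 0).
[cite: Balaban1985RegularSpaces, (1.56) p.86] -/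
theorem diagonal_mulVec_eq_iff (ℓ : q → ℝ) (hℓ : ∀ i, ℓ i ≠ 0) (v B₁ : q → ℝ) :
    diagonal ℓ *ᵥ v = B₁ ↔ v = lev ℓ 1 *ᵥ B₁ := by
  constructor
  · intro h
    funext i
    have hi := congrFun h i
    rw [mulVec_diagonal] at hi
    rw [lev_mulVec, pow_one, ← hi, ← mul_assoc, inv_mul_cancel₀ (hℓ i), one_mul]
  · intro h
    funext i
    rw [mulVec_diagonal, h, lev_mulVec, pow_one, ← mul_assoc, mul_inv_cancel₀ (hℓ i), one_mul]

/-- A diagonal matrix with non-zero entries kills only the zero vector. [folklore] -/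
private theorem eq_zero_of_diagonal_mulVec_eq_zero (ℓ : q → ℝ) (hℓ : ∀ i, ℓ i ≠ 0) (v : q → ℝ) (h : diagonal ℓ *ᵥ v = 0) :
    v = 0 := by
  funext i
  have hi := congrFun h i
  rw [mulVec_diagonal, Pi.zero_apply] at hi
  exact (mul_eq_zero.mp hi).resolve_left (hℓ i)

end Weights

section Operator

variable {b p n q : Type*} [Fintype p] [Fintype n] [Fintype q] [DecidableEq q]

/-- **The operator inside G(U₀)**: P₈ = D^{η\*}_{U₀}D^η_{U₀} + D^η_{U₀}R(U₀)D^{η\*}_{U₀} + Σ_jQ\*_jΛ_j(L^jη)^{−2}Q_j, read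
`CᵀC + DRDᵀ + Qjᵀ·lev ℓ 2·Qj`. [cite: Balaban1985RegularSpaces, (1.58) p.86] -/
noncomputable def P8 (C : Matrix p b ℝ) (D : Matrix b n ℝ) (R : Matrix n n ℝ) (Qj : Matrix q b ℝ) (ℓ : q → ℝ) :
    Matrix b b ℝ :=
  Cᵀ * C + D * R * Dᵀ + Qjᵀ * lev ℓ 2 * Qj

/-- P₈ is symmetric when R(U₀) is (R(U₀) = an orthogonal projection, [4] (3.20)). [cite: Balaban1985RegularSpaces, (1.58) p.86] -/
theorem P8_transpose (C : Matrix p b ℝ) (D : Matrix b n ℝ) (R : Matrix n n ℝ) (Qj : Matrix q b ℝ) (ℓ : q → ℝ)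
    (hR : Rᵀ = R) : (P8 C D R Qj ℓ)ᵀ = P8 C D R Qj ℓ := by
  simp only [P8, transpose_add, transpose_mul, transpose_transpose, hR, lev_transpose, Matrix.mul_assoc]

variable [Fintype b]

/-- P₈ applied to a vector field: `P₈X = CᵀCX + D(R(DᵀX)) + Qjᵀ(lev ℓ 2 (Qj X))`. [cite: Balaban1985RegularSpaces, (1.58) p.86] -/
theorem P8_mulVec (C : Matrix p b ℝ) (D : Matrix b n ℝ) (R : Matrix n n ℝ) (Qj : Matrix q b ℝ) (ℓ : q → ℝ)
    (X : b → ℝ) : P8 C D R Qj ℓ *ᵥ X =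
      (Cᵀ * C) *ᵥ X + D *ᵥ (R *ᵥ (Dᵀ *ᵥ X)) + Qjᵀ *ᵥ (lev ℓ 2 *ᵥ (Qj *ᵥ X)) := by
  simp only [P8, add_mulVec, mulVec_mulVec, Matrix.mul_assoc]

/-- **(1.56) ⇒ «hence L^jηQ_jA = B₁, B₁ = B − C_j(L^jηA) on Λ_j»**: if Q_j(U₀, ηA) = L^jηQ_jA + C_j(L^jηA) ((1.56); the vector
`cj` standing for the values C_j(L^jηA) on 𝔅_k) equals B on every Λ_j ((1.42)), then L^jηQ_jA = B − C_j(L^jηA) =: B₁.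
[cite: Balaban1985RegularSpaces, (1.56) p.86] -/
theorem eq156_B1 (Qj : Matrix q b ℝ) (ℓ : q → ℝ) (A : b → ℝ) (cj B : q → ℝ)
    (h142 : diagonal ℓ *ᵥ (Qj *ᵥ A) + cj = B) : diagonal ℓ *ᵥ (Qj *ᵥ A) = B - cj :=
  eq_sub_of_add_eq h142

/-- **(1.57)**: «We make the translation A = A₁ + H(U₀)B₁ … and we get the equations D\*DA₁ = J − D\*DH(U₀)B₁, Q_jA₁ = 0 on Λ_j,
R(U₀)D\*A₁ = 0.»  For ANY matrix `H` having the two properties (45) of [B11] at B₁ — L^jηQ_jHB₁ = B₁ on Λ_j and RD\*HB₁ = 0,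
which is what «defined in [4]» ((3.110)) provides (§2) — and any A with (1.55) D\*DA = J, (1.42) RD\*A = 0 and «L^jηQ_jA = B₁»;
A₁ = A − HB₁. [cite: Balaban1985RegularSpaces, (1.57) p.86] -/
theorem eq157 (C : Matrix p b ℝ) (D : Matrix b n ℝ) (R : Matrix n n ℝ) (Qj : Matrix q b ℝ) (ℓ : q → ℝ)
    (hℓ : ∀ i, ℓ i ≠ 0) (H : Matrix b q ℝ) {A J : b → ℝ} {B₁ : q → ℝ}
    (h55 : (Cᵀ * C) *ᵥ A = J) (h42 : R *ᵥ (Dᵀ *ᵥ A) = 0) (h56 : diagonal ℓ *ᵥ (Qj *ᵥ A) = B₁)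
    (h45a : diagonal ℓ *ᵥ (Qj *ᵥ (H *ᵥ B₁)) = B₁) (h45b : R *ᵥ (Dᵀ *ᵥ (H *ᵥ B₁)) = 0) :
    (Cᵀ * C) *ᵥ (A - H *ᵥ B₁) = J - (Cᵀ * C) *ᵥ (H *ᵥ B₁) ∧ Qj *ᵥ (A - H *ᵥ B₁) = 0 ∧
      R *ᵥ (Dᵀ *ᵥ (A - H *ᵥ B₁)) = 0 := by
  refine ⟨?_, ?_, ?_⟩
  · rw [mulVec_sub, h55]
  · apply eq_zero_of_diagonal_mulVec_eq_zero ℓ hℓ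
    rw [mulVec_sub, mulVec_sub, h56, h45a, sub_self]
  · rw [mulVec_sub, mulVec_sub, h42, h45b, sub_self]

/-- (1.57) fed into P₈: `P₈A₁ = J − D\*DH(U₀)B₁` (the DRD\* and Q-terms of P₈ vanish on A₁ by the last two equations of
(1.57)). [cite: Balaban1985RegularSpaces, (1.57)–(1.58) p.86] -/
theorem P8_mulVec_A1 (C : Matrix p b ℝ) (D : Matrix b n ℝ) (R : Matrix n n ℝ) (Qj : Matrix q b ℝ) (ℓ : q → ℝ)
    (hℓ : ∀ i, ℓ i ≠ 0) (H : Matrix b q ℝ) {A J : b → ℝ} {B₁ : q → ℝ}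
    (h55 : (Cᵀ * C) *ᵥ A = J) (h42 : R *ᵥ (Dᵀ *ᵥ A) = 0) (h56 : diagonal ℓ *ᵥ (Qj *ᵥ A) = B₁)
    (h45a : diagonal ℓ *ᵥ (Qj *ᵥ (H *ᵥ B₁)) = B₁) (h45b : R *ᵥ (Dᵀ *ᵥ (H *ᵥ B₁)) = 0) :
    P8 C D R Qj ℓ *ᵥ (A - H *ᵥ B₁) = J - (Cᵀ * C) *ᵥ (H *ᵥ B₁) := by
  obtain ⟨h1, h2, h3⟩ := eq157 C D R Qj ℓ hℓ H h55 h42 h56 h45a h45b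
  rw [P8_mulVec, h1, h3, h2, mulVec_zero, mulVec_zero, mulVec_zero, add_zero, add_zero]

/-- P₈ on the translation term: `P₈(H(U₀)B₁) = D\*DH(U₀)B₁ + Σ_jQ\*_jΛ_j(L^jη)^{−3}B₁` — by (45): RD\*HB₁ = 0 and Q_jHB₁ =
(L^jη)^{−1}B₁ on Λ_j. [cite: Balaban1985RegularSpaces, (1.58) p.86] -/
theorem P8_mulVec_H (C : Matrix p b ℝ) (D : Matrix b n ℝ) (R : Matrix n n ℝ) (Qj : Matrix q b ℝ) (ℓ : q → ℝ)
    (hℓ : ∀ i, ℓ i ≠ 0) (H : Matrix b q ℝ) {B₁ : q → ℝ}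
    (h45a : diagonal ℓ *ᵥ (Qj *ᵥ (H *ᵥ B₁)) = B₁) (h45b : R *ᵥ (Dᵀ *ᵥ (H *ᵥ B₁)) = 0) :
    P8 C D R Qj ℓ *ᵥ (H *ᵥ B₁) = (Cᵀ * C) *ᵥ (H *ᵥ B₁) + Qjᵀ *ᵥ (lev ℓ 3 *ᵥ B₁) := by
  have hq : Qj *ᵥ (H *ᵥ B₁) = lev ℓ 1 *ᵥ B₁ := (diagonal_mulVec_eq_iff ℓ hℓ _ _).mp h45a
  rw [P8_mulVec, h45b, mulVec_zero, add_zero, hq, mulVec_mulVec B₁ (lev ℓ 2) (lev ℓ 1), lev_mul_lev]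

/-- P₈ on A itself, H(U₀)-FREE: `P₈A = J + Σ_jQ\*_jΛ_j(L^jη)^{−3}B₁` from (1.55), (1.42), «L^jηQ_jA = B₁» alone — the route of
`B8FromB9.b8_158_identity` («H(U₀) cancels»). [cite: Balaban1985RegularSpaces, (1.58) p.86] -/
theorem P8_mulVec_A (C : Matrix p b ℝ) (D : Matrix b n ℝ) (R : Matrix n n ℝ) (Qj : Matrix q b ℝ) (ℓ : q → ℝ)
    (hℓ : ∀ i, ℓ i ≠ 0) {A J : b → ℝ} {B₁ : q → ℝ}
    (h55 : (Cᵀ * C) *ᵥ A = J) (h42 : R *ᵥ (Dᵀ *ᵥ A) = 0) (h56 : diagonal ℓ *ᵥ (Qj *ᵥ A) = B₁) :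
    P8 C D R Qj ℓ *ᵥ A = J + Qjᵀ *ᵥ (lev ℓ 3 *ᵥ B₁) := by
  have hq : Qj *ᵥ A = lev ℓ 1 *ᵥ B₁ := (diagonal_mulVec_eq_iff ℓ hℓ _ _).mp h56
  rw [P8_mulVec, h55, h42, mulVec_zero, add_zero, hq, mulVec_mulVec B₁ (lev ℓ 2) (lev ℓ 1), lev_mul_lev]

/-- THE QUADRATIC FORM OF P₈: for R(U₀) an orthogonal projection (Rᵀ = R = R²),
`⟨X, P₈X⟩ = ‖D^η_{U₀}X‖² + ‖R(U₀)D^{η\*}_{U₀}X‖² + Σ_jΣ_{Λ_j}(L^jη)^{−2}|Q_jX|²` (cf. [4] (3.16), (3.26)).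
[cite: Balaban1985RegularSpaces, (1.58) p.86] -/
theorem quadForm_P8 (C : Matrix p b ℝ) (D : Matrix b n ℝ) (R : Matrix n n ℝ) (Qj : Matrix q b ℝ) (ℓ : q → ℝ)
    (hR : Rᵀ = R) (hR2 : R * R = R) (X : b → ℝ) :
    X ⬝ᵥ P8 C D R Qj ℓ *ᵥ X = (C *ᵥ X) ⬝ᵥ (C *ᵥ X) + (R *ᵥ (Dᵀ *ᵥ X)) ⬝ᵥ (R *ᵥ (Dᵀ *ᵥ X)) +
      (lev ℓ 1 *ᵥ (Qj *ᵥ X)) ⬝ᵥ (lev ℓ 1 *ᵥ (Qj *ᵥ X)) := by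
  have h1 : X ⬝ᵥ (Cᵀ * C) *ᵥ X = (C *ᵥ X) ⬝ᵥ (C *ᵥ X) := by
    rw [← mulVec_mulVec, dotProduct_mulVec, vecMul_transpose]
  have h2 : X ⬝ᵥ D *ᵥ (R *ᵥ (Dᵀ *ᵥ X)) = (R *ᵥ (Dᵀ *ᵥ X)) ⬝ᵥ (R *ᵥ (Dᵀ *ᵥ X)) := by
    rw [dotProduct_mulVec, ← mulVec_transpose]
    set y := Dᵀ *ᵥ X
    conv_lhs => rw [← hR2]
    rw [← mulVec_mulVec, dotProduct_mulVec, ← mulVec_transpose, hR]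
  have h3 : X ⬝ᵥ Qjᵀ *ᵥ (lev ℓ 2 *ᵥ (Qj *ᵥ X)) = (lev ℓ 1 *ᵥ (Qj *ᵥ X)) ⬝ᵥ (lev ℓ 1 *ᵥ (Qj *ᵥ X)) := by
    have h11 : lev ℓ 2 = lev ℓ 1 * lev ℓ 1 := by rw [lev_mul_lev]
    rw [dotProduct_mulVec, vecMul_transpose, h11, ← mulVec_mulVec, dotProduct_mulVec, ← mulVec_transpose,
      lev_transpose]
  rw [P8_mulVec, dotProduct_add, dotProduct_add, h1, h2, h3]

/-- NO ZERO MODES ⇒ G(U₀) EXISTS: if no X ≠ 0 has D^η_{U₀}X = 0, R(U₀)D^{η\*}_{U₀}X = 0 and Q_jX = 0 on all Λ_j, then P₈ is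
positive definite (R(U₀) an orthogonal projection, L^jη ≠ 0) — the finite-dimensional reading, for B8's operator, of [4]
Thm 3.11 «Δ_a, G are positive definite». [cite: Balaban1985RegularSpaces, (1.58) p.86] -/
theorem posDef_P8_of_noZeroModes (C : Matrix p b ℝ) (D : Matrix b n ℝ) (R : Matrix n n ℝ) (Qj : Matrix q b ℝ)
    (ℓ : q → ℝ) (hℓ : ∀ i, ℓ i ≠ 0) (hR : Rᵀ = R) (hR2 : R * R = R)
    (h0 : ∀ X : b → ℝ, C *ᵥ X = 0 → R *ᵥ (Dᵀ *ᵥ X) = 0 → Qj *ᵥ X = 0 → X = 0) :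
    (P8 C D R Qj ℓ).PosDef := by
  refine Matrix.PosDef.of_dotProduct_mulVec_pos ?_ fun X hX => ?_
  · exact Matrix.isHermitian_iff_isSymm.mpr (P8_transpose C D R Qj ℓ hR)
  · rw [star_trivial, quadForm_P8 C D R Qj ℓ hR hR2]
    have s1 := dotProduct_star_self_nonneg (C *ᵥ X)
    have s2 := dotProduct_star_self_nonneg (R *ᵥ (Dᵀ *ᵥ X))
    have s3 := dotProduct_star_self_nonneg (lev ℓ 1 *ᵥ (Qj *ᵥ X))
    rw [star_trivial] at s1 s2 s3
    by_contra hle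
    have hle' := not_lt.mp hle
    have e1 : (C *ᵥ X) ⬝ᵥ (C *ᵥ X) = 0 := by linarith
    have e2 : (R *ᵥ (Dᵀ *ᵥ X)) ⬝ᵥ (R *ᵥ (Dᵀ *ᵥ X)) = 0 := by linarith
    have e3 : (lev ℓ 1 *ᵥ (Qj *ᵥ X)) ⬝ᵥ (lev ℓ 1 *ᵥ (Qj *ᵥ X)) = 0 := by linarith
    rw [dotProduct_self_eq_zero] at e1 e2 e3
    have e3' : Qj *ᵥ X = 0 := by
      funext i
      have hi := congrFun e3 i
      rw [lev_mulVec, pow_one, Pi.zero_apply] at hi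
      exact (mul_eq_zero.mp hi).resolve_left (inv_ne_zero (hℓ i))
    exact hX (h0 X e1 e2 e3')

end Operator

section Inverse

variable {b p n q : Type*} [Fintype b] [Fintype p] [Fintype n] [Fintype q] [DecidableEq q] [DecidableEq b]

/-- **G(U₀) = (D^{η\*}_{U₀}D^η_{U₀} + D^η_{U₀}R(U₀)D^{η\*}_{U₀} + Σ_jQ\*_jΛ_j(L^jη)^{−2}Q_j)^{−1}** — «introduced and investigated
in [4]. Let us recall only the definition» — as the matrix inverse of `P8` (meaningful under `IsUnit (P8 …).det`, the
displayed hypothesis of every use below). [cite: Balaban1985RegularSpaces, (1.58) p.86] -/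
noncomputable def G8 (C : Matrix p b ℝ) (D : Matrix b n ℝ) (R : Matrix n n ℝ) (Qj : Matrix q b ℝ) (ℓ : q → ℝ) :
    Matrix b b ℝ :=
  (P8 C D R Qj ℓ)⁻¹

/-- `G(U₀)·P₈ = 1`. [cite: Balaban1985RegularSpaces, (1.58) p.86] -/
theorem G8_mul_P8 (C : Matrix p b ℝ) (D : Matrix b n ℝ) (R : Matrix n n ℝ) (Qj : Matrix q b ℝ) (ℓ : q → ℝ)
    (hG : IsUnit (P8 C D R Qj ℓ).det) : G8 C D R Qj ℓ * P8 C D R Qj ℓ = 1 :=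
  nonsing_inv_mul _ hG

/-- `P₈·G(U₀) = 1`. [cite: Balaban1985RegularSpaces, (1.58) p.86] -/
theorem P8_mul_G8 (C : Matrix p b ℝ) (D : Matrix b n ℝ) (R : Matrix n n ℝ) (Qj : Matrix q b ℝ) (ℓ : q → ℝ)
    (hG : IsUnit (P8 C D R Qj ℓ).det) : P8 C D R Qj ℓ * G8 C D R Qj ℓ = 1 :=
  mul_nonsing_inv _ hG

/-- A positive definite P₈ is invertible. [cite: Balaban1985RegularSpaces, (1.58) p.86] -/
theorem isUnit_P8_det_of_posDef (C : Matrix p b ℝ) (D : Matrix b n ℝ) (R : Matrix n n ℝ) (Qj : Matrix q b ℝ)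
    (ℓ : q → ℝ) (h : (P8 C D R Qj ℓ).PosDef) : IsUnit (P8 C D R Qj ℓ).det :=
  (isUnit_iff_isUnit_det _).mp h.isUnit

/-- `X = G(U₀)(P₈X)`. [cite: Balaban1985RegularSpaces, (1.58) p.86] -/
theorem eq_G8_mulVec_P8_mulVec (C : Matrix p b ℝ) (D : Matrix b n ℝ) (R : Matrix n n ℝ) (Qj : Matrix q b ℝ)
    (ℓ : q → ℝ) (hG : IsUnit (P8 C D R Qj ℓ).det) (X : b → ℝ) :
    X = G8 C D R Qj ℓ *ᵥ (P8 C D R Qj ℓ *ᵥ X) := by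
  rw [mulVec_mulVec, G8_mul_P8 C D R Qj ℓ hG, one_mulVec]

/-- **(1.58), FIRST LINE**: «They imply finally A = G(U₀)J − G(U₀)D^{η\*}_{U₀}D_{U₀}H(U₀)B₁ + H(U₀)B₁» — from (1.57):
A₁ = G(U₀)(P₈A₁) = G(U₀)(J − D\*DH(U₀)B₁) and A = A₁ + H(U₀)B₁. [cite: Balaban1985RegularSpaces, (1.58) p.86] -/
theorem eq158_line1 (C : Matrix p b ℝ) (D : Matrix b n ℝ) (R : Matrix n n ℝ) (Qj : Matrix q b ℝ) (ℓ : q → ℝ)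
    (hℓ : ∀ i, ℓ i ≠ 0) (hG : IsUnit (P8 C D R Qj ℓ).det) (H : Matrix b q ℝ) {A J : b → ℝ} {B₁ : q → ℝ}
    (h55 : (Cᵀ * C) *ᵥ A = J) (h42 : R *ᵥ (Dᵀ *ᵥ A) = 0) (h56 : diagonal ℓ *ᵥ (Qj *ᵥ A) = B₁)
    (h45a : diagonal ℓ *ᵥ (Qj *ᵥ (H *ᵥ B₁)) = B₁) (h45b : R *ᵥ (Dᵀ *ᵥ (H *ᵥ B₁)) = 0) :
    A = G8 C D R Qj ℓ *ᵥ J - G8 C D R Qj ℓ *ᵥ ((Cᵀ * C) *ᵥ (H *ᵥ B₁)) + H *ᵥ B₁ := by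
  have h := eq_G8_mulVec_P8_mulVec C D R Qj ℓ hG (A - H *ᵥ B₁)
  rw [P8_mulVec_A1 C D R Qj ℓ hℓ H h55 h42 h56 h45a h45b, mulVec_sub] at h
  exact sub_eq_iff_eq_add.mp h

/-- **(1.58), SECOND LINE**: «= G(U₀)J + G(U₀)Σ_jQ\*_jΛ_j(L^jη)⁻³B₁» — H(U₀)-free: A = G(U₀)(P₈A) with `P8_mulVec_A`.
[cite: Balaban1985RegularSpaces, (1.58) p.86] -/
theorem eq158_line2 (C : Matrix p b ℝ) (D : Matrix b n ℝ) (R : Matrix n n ℝ) (Qj : Matrix q b ℝ) (ℓ : q → ℝ)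
    (hℓ : ∀ i, ℓ i ≠ 0) (hG : IsUnit (P8 C D R Qj ℓ).det) {A J : b → ℝ} {B₁ : q → ℝ}
    (h55 : (Cᵀ * C) *ᵥ A = J) (h42 : R *ᵥ (Dᵀ *ᵥ A) = 0) (h56 : diagonal ℓ *ᵥ (Qj *ᵥ A) = B₁) :
    A = G8 C D R Qj ℓ *ᵥ J + G8 C D R Qj ℓ *ᵥ (Qjᵀ *ᵥ (lev ℓ 3 *ᵥ B₁)) := by
  have h := eq_G8_mulVec_P8_mulVec C D R Qj ℓ hG A
  rwa [P8_mulVec_A C D R Qj ℓ hℓ h55 h42 h56, mulVec_add] at h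

/-- THE MIDDLE EQUALITY OF (1.58) ON ITS OWN: «G(U₀)J − G(U₀)D\*DH(U₀)B₁ + H(U₀)B₁ = G(U₀)J + G(U₀)Σ_jQ\*_jΛ_j(L^jη)⁻³B₁» holds for
EVERY J and B₁ as soon as H(U₀) has the properties (45) at B₁ — from `P8_mulVec_H`: H(U₀)B₁ = G(U₀)D\*DH(U₀)B₁ +
G(U₀)Σ_jQ\*_jΛ_j(L^jη)⁻³B₁. [cite: Balaban1985RegularSpaces, (1.58) p.86] -/
theorem eq158_rhs (C : Matrix p b ℝ) (D : Matrix b n ℝ) (R : Matrix n n ℝ) (Qj : Matrix q b ℝ) (ℓ : q → ℝ)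
    (hℓ : ∀ i, ℓ i ≠ 0) (hG : IsUnit (P8 C D R Qj ℓ).det) (H : Matrix b q ℝ) (J : b → ℝ) {B₁ : q → ℝ}
    (h45a : diagonal ℓ *ᵥ (Qj *ᵥ (H *ᵥ B₁)) = B₁) (h45b : R *ᵥ (Dᵀ *ᵥ (H *ᵥ B₁)) = 0) :
    G8 C D R Qj ℓ *ᵥ J - G8 C D R Qj ℓ *ᵥ ((Cᵀ * C) *ᵥ (H *ᵥ B₁)) + H *ᵥ B₁ =
      G8 C D R Qj ℓ *ᵥ J + G8 C D R Qj ℓ *ᵥ (Qjᵀ *ᵥ (lev ℓ 3 *ᵥ B₁)) := by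
  have h := eq_G8_mulVec_P8_mulVec C D R Qj ℓ hG (H *ᵥ B₁)
  rw [P8_mulVec_H C D R Qj ℓ hℓ H h45a h45b, mulVec_add] at h
  linear_combination h

/-- **(1.58)** as printed — both lines, for A with (1.55), (1.42), «L^jηQ_jA = B₁» and any H(U₀) with (45) at B₁:
«A = G(U₀)J − G(U₀)D\*DH(U₀)B₁ + H(U₀)B₁ = G(U₀)J + G(U₀)Σ_jQ\*_jΛ_j(L^jη)⁻³B₁». [cite: Balaban1985RegularSpaces, (1.58) p.86] -/
theorem eq158 (C : Matrix p b ℝ) (D : Matrix b n ℝ) (R : Matrix n n ℝ) (Qj : Matrix q b ℝ) (ℓ : q → ℝ)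
    (hℓ : ∀ i, ℓ i ≠ 0) (hG : IsUnit (P8 C D R Qj ℓ).det) (H : Matrix b q ℝ) {A J : b → ℝ} {B₁ : q → ℝ}
    (h55 : (Cᵀ * C) *ᵥ A = J) (h42 : R *ᵥ (Dᵀ *ᵥ A) = 0) (h56 : diagonal ℓ *ᵥ (Qj *ᵥ A) = B₁)
    (h45a : diagonal ℓ *ᵥ (Qj *ᵥ (H *ᵥ B₁)) = B₁) (h45b : R *ᵥ (Dᵀ *ᵥ (H *ᵥ B₁)) = 0) :
    A = G8 C D R Qj ℓ *ᵥ J - G8 C D R Qj ℓ *ᵥ ((Cᵀ * C) *ᵥ (H *ᵥ B₁)) + H *ᵥ B₁ ∧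
      G8 C D R Qj ℓ *ᵥ J - G8 C D R Qj ℓ *ᵥ ((Cᵀ * C) *ᵥ (H *ᵥ B₁)) + H *ᵥ B₁ =
        G8 C D R Qj ℓ *ᵥ J + G8 C D R Qj ℓ *ᵥ (Qjᵀ *ᵥ (lev ℓ 3 *ᵥ B₁)) :=
  ⟨eq158_line1 C D R Qj ℓ hℓ hG H h55 h42 h56 h45a h45b, eq158_rhs C D R Qj ℓ hℓ hG H J h45a h45b⟩

/-- G(U₀) EXISTS ⇒ NO ZERO MODES: under `IsUnit (P8 …).det`, a vector field with D^η_{U₀}X = 0, R(U₀)D^{η\*}_{U₀}X = 0 and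
Q_jX = 0 on all Λ_j vanishes. [cite: Balaban1985RegularSpaces, (1.58) p.86] -/
theorem eq_zero_of_modes (C : Matrix p b ℝ) (D : Matrix b n ℝ) (R : Matrix n n ℝ) (Qj : Matrix q b ℝ) (ℓ : q → ℝ)
    (hG : IsUnit (P8 C D R Qj ℓ).det) (X : b → ℝ) (hC : C *ᵥ X = 0) (hRD : R *ᵥ (Dᵀ *ᵥ X) = 0)
    (hQ : Qj *ᵥ X = 0) : X = 0 := by
  rw [eq_G8_mulVec_P8_mulVec C D R Qj ℓ hG X, P8_mulVec, ← mulVec_mulVec, hC, hRD, hQ, mulVec_zero, mulVec_zero,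
    mulVec_zero, mulVec_zero, add_zero, add_zero, mulVec_zero]

/-- **B8's G(U₀) exists iff there are no zero modes** (R(U₀) an orthogonal projection, L^jη ≠ 0): `IsUnit (P8 …).det ↔
∀ X, D^η_{U₀}X = 0 → R(U₀)D^{η\*}_{U₀}X = 0 → (∀ j, Q_jX = 0 on Λ_j) → X = 0` — the finite-dimensional content, for B8's
operator, of [4] Thm 3.11 «Δ_a, G are positive definite». [cite: Balaban1985RegularSpaces, (1.58) p.86] -/
theorem isUnit_P8_det_iff (C : Matrix p b ℝ) (D : Matrix b n ℝ) (R : Matrix n n ℝ) (Qj : Matrix q b ℝ) (ℓ : q → ℝ)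
    (hℓ : ∀ i, ℓ i ≠ 0) (hR : Rᵀ = R) (hR2 : R * R = R) :
    IsUnit (P8 C D R Qj ℓ).det ↔ ∀ X : b → ℝ, C *ᵥ X = 0 → R *ᵥ (Dᵀ *ᵥ X) = 0 → Qj *ᵥ X = 0 → X = 0 :=
  ⟨fun hG X hC hRD hQ => eq_zero_of_modes C D R Qj ℓ hG X hC hRD hQ,
    fun h0 => isUnit_P8_det_of_posDef C D R Qj ℓ (posDef_P8_of_noZeroModes C D R Qj ℓ hℓ hR hR2 h0)⟩

end Inverse

/-! ## §2  «where the operator H(U₀) was defined in [4]»: H(U₀) := the minimiser of (3.109)–(3.110), `B9Eq3112.hOp`, and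
R(U₀) := the projection (3.25), `B9H163.R` -/

section SectD

variable {b p n m τ q σ : Type*} [Fintype b] [Fintype p] [Fintype n] [Fintype m] [Fintype τ] [Fintype q]
variable [DecidableEq b] [DecidableEq n] [DecidableEq m] [DecidableEq τ] [DecidableEq q]

/-- **H(U₀) «defined in [4]» HAS THE PROPERTIES (45)**: with [4]'s letters of `B9Eq3112` — Δ = DᵀD the site Laplacian, Q = Q′(U₀)
with kernel basis N, the parameter a, R(U₀) = `B9H163.R Δ Q a` ((3.25)), the bond form K of (3.109), and [4]'s constraint
operator «Q(U)A := L^jηQ_j(U)A» = `diagonal ℓ * Qj` — the minimiser `H := B9Eq3112.hOp K Δ N D (diagonal ℓ * Qj)` satisfies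
L^jηQ_jHB = B on Λ_j and R(U₀)D\*HB = 0 for every B (under the nonsingularity `hW` of the bordered matrix of (3.109)–(3.110),
which [4]'s «positive definiteness of the operator Δ_a» supplies: `B9Eq3112.isUnit_kkt_dcon`).
[cite: Balaban1985BackgroundPropagators, (3.109)-(3.111) p.417] -/
theorem hOp_prop45 (e : n ≃ τ ⊕ m) (K : Matrix b b ℝ) (Δ : Matrix n n ℝ) (Q : Matrix m n ℝ) (a : ℝ)
    (hΔ : Δ.IsSymm) (hΔ' : IsUnit (B9H163.Δ' Δ Q a)) (N : Matrix n τ ℝ) (hQN : Q * N = 0)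
    (hQM : IsUnit (Q * Qᵀ).det) (hTs : IsUnit (Nᵀ * (Δ * Δ) * N).det) (D : Matrix b n ℝ) (Qj : Matrix q b ℝ)
    (ℓ : q → ℝ) (hW : IsUnit (kkt K (dcon Δ N D (diagonal ℓ * Qj))).det) (B : q → ℝ) :
    diagonal ℓ *ᵥ (Qj *ᵥ (hOp K Δ N D (diagonal ℓ * Qj) *ᵥ B)) = B ∧
      B9H163.R Δ Q a *ᵥ (Dᵀ *ᵥ (hOp K Δ N D (diagonal ℓ * Qj) *ᵥ B)) = 0 := by
  have h := B9Eq3112.hOp_feasible e K Δ Q a hΔ hΔ' N hQN hQM hTs D (diagonal ℓ * Qj) hW B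
  rw [← mulVec_mulVec] at h
  exact h

/-- **(1.57) WITH [4]'s H(U₀)**: for every A with (1.55) D\*DA = J, (1.42) R(U₀)D\*A = 0 and «L^jηQ_jA = B₁ on Λ_j», the
translation A = A₁ + H(U₀)B₁ by the (3.109)–(3.110) minimiser gives «D\*DA₁ = J − D\*DH(U₀)B₁, Q_jA₁ = 0 on Λ_j, R(U₀)D\*A₁ = 0».
[cite: Balaban1985RegularSpaces, (1.57) p.86] -/
theorem eq157_sectD (e : n ≃ τ ⊕ m) (K : Matrix b b ℝ) (Δ : Matrix n n ℝ) (Q : Matrix m n ℝ) (a : ℝ)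
    (hΔ : Δ.IsSymm) (hΔ' : IsUnit (B9H163.Δ' Δ Q a)) (N : Matrix n τ ℝ) (hQN : Q * N = 0)
    (hQM : IsUnit (Q * Qᵀ).det) (hTs : IsUnit (Nᵀ * (Δ * Δ) * N).det) (D : Matrix b n ℝ) (Qj : Matrix q b ℝ)
    (ℓ : q → ℝ) (hℓ : ∀ i, ℓ i ≠ 0) (hW : IsUnit (kkt K (dcon Δ N D (diagonal ℓ * Qj))).det) (C : Matrix p b ℝ)
    {A J : b → ℝ} {B₁ : q → ℝ} (h55 : (Cᵀ * C) *ᵥ A = J) (h42 : B9H163.R Δ Q a *ᵥ (Dᵀ *ᵥ A) = 0)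
    (h56 : diagonal ℓ *ᵥ (Qj *ᵥ A) = B₁) :
    (Cᵀ * C) *ᵥ (A - hOp K Δ N D (diagonal ℓ * Qj) *ᵥ B₁) =
        J - (Cᵀ * C) *ᵥ (hOp K Δ N D (diagonal ℓ * Qj) *ᵥ B₁) ∧
      Qj *ᵥ (A - hOp K Δ N D (diagonal ℓ * Qj) *ᵥ B₁) = 0 ∧
      B9H163.R Δ Q a *ᵥ (Dᵀ *ᵥ (A - hOp K Δ N D (diagonal ℓ * Qj) *ᵥ B₁)) = 0 := by
  obtain ⟨h45a, h45b⟩ := hOp_prop45 e K Δ Q a hΔ hΔ' N hQN hQM hTs D Qj ℓ hW B₁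
  exact eq157 C D (B9H163.R Δ Q a) Qj ℓ hℓ _ h55 h42 h56 h45a h45b

/-- **(1.58) WITH [4]'s H(U₀) AND B8's G(U₀)**, both lines: «A = G(U₀)J − G(U₀)D\*DH(U₀)B₁ + H(U₀)B₁ = G(U₀)J +
G(U₀)Σ_jQ\*_jΛ_j(L^jη)⁻³B₁», G(U₀) = `G8 C D (R(U₀)) Qj ℓ` (under the displayed invertibility `hG` of B8's operator).
[cite: Balaban1985RegularSpaces, (1.58) p.86] -/
theorem eq158_sectD (e : n ≃ τ ⊕ m) (K : Matrix b b ℝ) (Δ : Matrix n n ℝ) (Q : Matrix m n ℝ) (a : ℝ)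
    (hΔ : Δ.IsSymm) (hΔ' : IsUnit (B9H163.Δ' Δ Q a)) (N : Matrix n τ ℝ) (hQN : Q * N = 0)
    (hQM : IsUnit (Q * Qᵀ).det) (hTs : IsUnit (Nᵀ * (Δ * Δ) * N).det) (D : Matrix b n ℝ) (Qj : Matrix q b ℝ)
    (ℓ : q → ℝ) (hℓ : ∀ i, ℓ i ≠ 0) (hW : IsUnit (kkt K (dcon Δ N D (diagonal ℓ * Qj))).det) (C : Matrix p b ℝ)
    (hG : IsUnit (P8 C D (B9H163.R Δ Q a) Qj ℓ).det)
    {A J : b → ℝ} {B₁ : q → ℝ} (h55 : (Cᵀ * C) *ᵥ A = J) (h42 : B9H163.R Δ Q a *ᵥ (Dᵀ *ᵥ A) = 0)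
    (h56 : diagonal ℓ *ᵥ (Qj *ᵥ A) = B₁) :
    A = G8 C D (B9H163.R Δ Q a) Qj ℓ *ᵥ J -
          G8 C D (B9H163.R Δ Q a) Qj ℓ *ᵥ ((Cᵀ * C) *ᵥ (hOp K Δ N D (diagonal ℓ * Qj) *ᵥ B₁)) +
          hOp K Δ N D (diagonal ℓ * Qj) *ᵥ B₁ ∧
      G8 C D (B9H163.R Δ Q a) Qj ℓ *ᵥ J -
          G8 C D (B9H163.R Δ Q a) Qj ℓ *ᵥ ((Cᵀ * C) *ᵥ (hOp K Δ N D (diagonal ℓ * Qj) *ᵥ B₁)) +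
          hOp K Δ N D (diagonal ℓ * Qj) *ᵥ B₁ =
        G8 C D (B9H163.R Δ Q a) Qj ℓ *ᵥ J + G8 C D (B9H163.R Δ Q a) Qj ℓ *ᵥ (Qjᵀ *ᵥ (lev ℓ 3 *ᵥ B₁)) := by
  obtain ⟨h45a, h45b⟩ := hOp_prop45 e K Δ Q a hΔ hΔ' N hQN hQM hTs D Qj ℓ hW B₁
  exact eq158 C D (B9H163.R Δ Q a) Qj ℓ hℓ hG _ h55 h42 h56 h45a h45b

variable [DecidableEq σ] [Fintype σ]

/-- The same with the bordered-matrix hypothesis `hW` DISCHARGED from [4]'s «positive definiteness of the operator Δ_a»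
((3.111); Thm 3.11): `B9Eq3112.isUnit_kkt_dcon` — inputs: K symmetric, D\*D = Δ, (3.115) «Q_jD = D̄_jQ′_j» for [4]'s
Q = L^jηQ_j, Q onto (QQᵀ nonsingular), Δ_a = K + DR(U₀)Dᵀ + a_bQᵀQ positive definite, and a kernel basis N_S of the
stacked constraint. [cite: Balaban1985BackgroundPropagators, (3.109)-(3.111) p.417] -/
theorem eq158_sectD_of_posDef (eS : b ≃ σ ⊕ (q ⊕ τ)) (e : n ≃ τ ⊕ m) (K : Matrix b b ℝ) (hK : Kᵀ = K)
    (Δ : Matrix n n ℝ) (Q : Matrix m n ℝ) (a : ℝ) (hΔ : Δ.IsSymm) (hΔ' : IsUnit (B9H163.Δ' Δ Q a))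
    (N : Matrix n τ ℝ) (hQN : Q * N = 0) (hQM : IsUnit (Q * Qᵀ).det) (hTs : IsUnit (Nᵀ * (Δ * Δ) * N).det)
    (D : Matrix b n ℝ) (hD : Dᵀ * D = Δ) (Qj : Matrix q b ℝ) (ℓ : q → ℝ) (hℓ : ∀ i, ℓ i ≠ 0)
    (Dbar : Matrix q m ℝ) (h115 : diagonal ℓ * Qj * D = Dbar * Q) (ab : ℝ)
    (hQbM : IsUnit (diagonal ℓ * Qj * (diagonal ℓ * Qj)ᵀ).det)
    (hΔa : (K + D * B9H163.R Δ Q a * Dᵀ + ab • ((diagonal ℓ * Qj)ᵀ * (diagonal ℓ * Qj))).PosDef)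
    (NS : Matrix b σ ℝ) (hSN : dcon Δ N D (diagonal ℓ * Qj) * NS = 0) (hNSA : IsUnit (NSᵀ * NS).det)
    (C : Matrix p b ℝ) (hG : IsUnit (P8 C D (B9H163.R Δ Q a) Qj ℓ).det)
    {A J : b → ℝ} {B₁ : q → ℝ} (h55 : (Cᵀ * C) *ᵥ A = J) (h42 : B9H163.R Δ Q a *ᵥ (Dᵀ *ᵥ A) = 0)
    (h56 : diagonal ℓ *ᵥ (Qj *ᵥ A) = B₁) :
    A = G8 C D (B9H163.R Δ Q a) Qj ℓ *ᵥ J -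
          G8 C D (B9H163.R Δ Q a) Qj ℓ *ᵥ ((Cᵀ * C) *ᵥ (hOp K Δ N D (diagonal ℓ * Qj) *ᵥ B₁)) +
          hOp K Δ N D (diagonal ℓ * Qj) *ᵥ B₁ ∧
      G8 C D (B9H163.R Δ Q a) Qj ℓ *ᵥ J -
          G8 C D (B9H163.R Δ Q a) Qj ℓ *ᵥ ((Cᵀ * C) *ᵥ (hOp K Δ N D (diagonal ℓ * Qj) *ᵥ B₁)) +
          hOp K Δ N D (diagonal ℓ * Qj) *ᵥ B₁ =
        G8 C D (B9H163.R Δ Q a) Qj ℓ *ᵥ J + G8 C D (B9H163.R Δ Q a) Qj ℓ *ᵥ (Qjᵀ *ᵥ (lev ℓ 3 *ᵥ B₁)) :=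
  eq158_sectD e K Δ Q a hΔ hΔ' N hQN hQM hTs D Qj ℓ hℓ
    (B9Eq3112.isUnit_kkt_dcon eS e K hK Δ Q a hΔ hΔ' N hQN hQM hTs D hD (diagonal ℓ * Qj) Dbar h115 ab hQbM hΔa
      NS hSN hNSA) C hG h55 h42 h56

end SectD

end Literature.MathematicalPhysics.QuantumFieldTheory.Balaban1983to89.B8Eq157Translation
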